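import Literature.Computability.Cryptography.HashAndSignOTSIndexed
import Literature.Computability.Cryptography.UOWHFPadding
import HarnessLib

/-!
# One-way functions + any UOWHF with indices of polynomial length ⇒ secure one-time signatures

Topic `Literature/Computability/Cryptography`; the interface of the one-time level of Goldreich's proof of
Thm. 6.4.1 (`secureSignaturesExist_of_OWFExist`) towards the "one-way functions ⇒ UOWHF" line
(`InaccessibleEntropyUOWHF*.lean`, Rompel 1990 = Goldreich 2004, Thm. 6.4.29). It combines

* `HashSign.exists_isOneTimeSecure_of_OWFExist_of_isUOWHF_idx` (`HashAndSignOTSIndexed.lean`: Prop. 6.4.31 over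
  Lamport's Construction 6.4.4, for a UOWHF whose indices at `1ⁿ` have length `q_I(n)` and whose range
  specifier is polynomial along these lengths), and
* `HashCollection.IsUOWHF.exists_polyRange` (`UOWHFPadding.lean`: padding the values makes the range specifier
  a polynomial, keeping the index sampler),

into the hypothesis-minimal statement **`exists_isOneTimeSecure_of_OWFExist_of_isUOWHF_poly`**: one-way
functions and a universal one-way hash family with ANY range specifier, a polynomial index-coin budget `p_I`
and indices of one polynomial length `q_I(n)` on `1ⁿ` give a secure one-time signature scheme; and the
existence form **`exists_isOneTimeSecure_of_OWFExist_of_exists_isUOWHF`**. With Goldreich's Thm. 6.4.29 in the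
format of `InaccessibleEntropyUOWHFFamily.lean` (indices `1ⁿ0r`, `|r| = p(n)`, so `q_I = p + X + 1`,
`coinLen = p`) this is Thm. 6.4.32 at the one-time level; with the authentication-tree step (Thm. 6.4.9) and
`secureSignaturesExist_of_OWFExist_of_oneTimeSecure` (`SchemesProofs.lean`) it assembles Thm. 6.4.1.

Everything is proved; no named facts.

## References

* O. Goldreich, *Foundations of Cryptography II: Basic Applications*, CUP 2004, Prop. 6.4.31, Cor. 6.4.6,
  Thm. 6.4.29, Thm. 6.4.32 and §6.4.3.4 (the assembly of Thm. 6.4.1).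
* J. Rompel, *One-way functions are necessary and sufficient for secure signatures*, STOC 1990, Thm. 1–3.
-/

namespace Literature.Computability.Cryptography

open Polynomial

/-- **One-way functions + a UOWHF with indices of polynomial length ⇒ secure one-time signatures** (no
hypothesis on the range specifier: the values are first padded to a polynomial length, `UOWHFPadding.lean`).
[Goldreich 2004, Prop. 6.4.31 with Cor. 6.4.6 and Def. 6.4.18] [cite: Goldreich2004, Prop. 6.4.31] -/
theorem exists_isOneTimeSecure_of_OWFExist_of_isUOWHF_poly (hOWF : OWFExist) {H : HashCollection} {ℓ' : ℕ → ℕ}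
    {qI pI : Polynomial ℕ} (hH : H.IsUOWHF ℓ') (hpI : ∀ n, H.index.coinLen n = pI.eval n)
    (hlen : ∀ n, ∀ s ∈ (H.indexPMF n).support, s.length = qI.eval n) : ∃ S' : SignatureScheme, S'.IsOneTimeSecure := by
  obtain ⟨H', P, hU', hidx⟩ := hH.exists_polyRange
  have hpI' : ∀ n, H'.index.coinLen n = pI.eval n := fun n => by rw [hidx]; exact hpI n
  have hlen' : ∀ n, ∀ s ∈ (H'.indexPMF n).support, s.length = qI.eval n := fun n s hs => by
    refine hlen n s ?_
    simpa only [HashCollection.indexPMF, hidx] using hs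
  exact HashSign.exists_isOneTimeSecure_of_OWFExist_of_isUOWHF_idx hOWF hU' (qI := qI) (ℓ'q := P.comp qI)
    (fun n => by simp only [eval_comp]) hpI' hlen'

/-- **Existence form**: one-way functions and the existence of a UOWHF with a polynomial index-coin budget and
indices of one polynomial length on each `1ⁿ` give secure one-time signature schemes. [Goldreich 2004,
Thm. 6.4.32 (one-time level) via Prop. 6.4.31] [cite: Goldreich2004, Prop. 6.4.31] -/
theorem exists_isOneTimeSecure_of_OWFExist_of_exists_isUOWHF (hOWF : OWFExist)
    (hU : ∃ (H : HashCollection) (ℓ' : ℕ → ℕ) (qI pI : Polynomial ℕ), H.IsUOWHF ℓ' ∧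
      (∀ n, H.index.coinLen n = pI.eval n) ∧ ∀ n, ∀ s ∈ (H.indexPMF n).support, s.length = qI.eval n) :
    ∃ S' : SignatureScheme, S'.IsOneTimeSecure := by
  obtain ⟨H, ℓ', qI, pI, hH, hpI, hlen⟩ := hU
  exact exists_isOneTimeSecure_of_OWFExist_of_isUOWHF_poly hOWF hH hpI hlen

end Literature.Computability.Cryptography
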